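import Literature.Probability.LatticeModels.ClusterExpansionActivityPaths
import HarnessLib

/-!
# The Kotecký–Preiss cluster-expansion estimate (4): proof

Discharge of the named fact `Literature.Probability.LatticeModels.koteckyPreiss_truncatedWeight_bound`
(`ClusterExpansion.lean`; [KP86, Theorem p. 492, estimate (4)]): for a countable polymer set with
a reflexive symmetric incompatibility `ι`, activities `w` and functions `a, d ≥ 0` with
(1) `Σ_{γ' ι γ} |w(γ')| e^{a(γ')+d(γ')} ≤ a(γ)`, the truncated functional satisfies
(4) `Σ_{C ι γ} |Φ^T(C)| e^{d(C)} ≤ a(γ)` for every polymer `γ`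
(`koteckyPreiss_truncatedWeight_bound_holds`). Everything is PROVED; the analytic inputs (chain
rule along activity paths, continuity of `log Z` and `Φ^T` in the activities, the log-increment
identity, the vanishing lemma (11)) are in the sibling `ClusterExpansionActivityPaths.lean`.

## The proof ([KP86, §3], made quantitative and finite-dimensional)

Fix a finite volume `L`; the statement `(S)` of [KP86] is `touchSum w γ ≤ a(γ)` for `γ ∈ L`,
where `touchSum w γ = Σ_{C ⊆ L, C ι γ} |Φ^T(C; w)| e^{d(C)}`.

1. **Möbius–exponential bound** (`sum_exp_mul_norm_moebius_le`, the combinatorial heart of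
   [KP86, p. 497, the estimate following (12)]): for any `g` on finite sets and any selection `T` of sets,
   `Σ_{C ⊆ L} e^{d(C)} |Σ_{B ⊆ C} (-1)^{|C∖B|} 1[δ ∈ B] exp(-Σ_{D ⊆ B, T D} g(D))| ≤ e^{d(δ)} exp(Σ_{D ⊆ L, T D} |g(D)| e^{d(D)})`:
   write `e^{-g} = 1 + h`, expand the product (`Finset.prod_one_add`), extract the families with
   marked support exactly `C` by Möbius inversion (`moebius_ite_mem_mul_cexp_eq`), use
   `d({δ} ∪ ⋃𝒟) ≤ d(δ) + Σ d(D)`, resum, and bound factorwise with `|e^{z} - 1| ≤ e^{|z|} - 1` and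
   Bernoulli `1 + y(eˣ - 1) ≤ e^{yx}` (`y = e^{d(D)} ≥ 1`).
2. **Derivative bound** (`touchSum_le_of_forall_scaleAt`, [KP86, (12) and p. 497]): along the path
   `Φ_t` scaling by `t` the activities of the polymers incompatible with `γ`,
   `Φ^T(C; Φ₀) = 0` (11), `Φ^T(C; Φ₁) = ∫₀¹ Σ_{B ⊆ C} (-1)^{|C∖B|} Ż_t(B)/Z_t(B) dt`
   (log-increment identity), `Ż_t(B)/Z_t(B) = Σ_{δ ∈ B, δ ι γ} Φ(δ) exp(-Σ_{D ⊆ B, D ι δ} Φ_t^T(D))`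
   (chain rule and [KP86, (5)]), so by step 1 and `(S)` for `Φ_t` at the `δ ι γ`:
   `touchSum Φ γ ≤ Σ_{δ ∈ L, δ ι γ} |Φ(δ)| e^{a(δ)+d(δ)}`.
3. **Real induction** (`touchSum_smul_le_of_kp`): the set of `s ∈ [0,1]` such that `(S)` holds
   for all functionals `s·c·w`, `c ∈ [0,1]^P`, contains `0`, is closed (continuity of `Φ^T` in
   the multipliers) and open to the right (step 2 gives the strict bound `≤ s·a(γ)`, propagated to
   `s₂ > s` by the tube lemma on `{s} × [0,1]^P`, the cube being compact); hence it is `[0,1]`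
   (`IsClosed.Icc_subset_of_forall_mem_nhdsWithin`). At `s = 1`, `c = 1` this is
   `touchSum_le_of_kp`.
4. **Countable polymer sets** (`koteckyPreiss_truncatedWeight_bound_holds`): a finite family of
   finite sets touching `γ` lies in a finite `L ∋ γ` on which (1) restricts; nonnegative series
   with bounded partial sums converge (`summable_of_sum_le`).

## References

* [KP86] R. Kotecký, D. Preiss, *Cluster expansion for abstract polymer models*, Comm. Math.
  Phys. 103 (1986) 491–498: Theorem p. 492 with (1)–(4), Proposition with (5), §3 (proof:
  (S), (9)–(12), and the derivative computation on p. 497; the display numbered (13) in the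
  journal version is not legible in the held scan, so we cite it by page). [KoteckyPreiss1986]
* S. Friedli, Y. Velenik, *Statistical Mechanics of Lattice Systems* (2017), Thm. 5.4
  (the tree-graph route to the same estimate, not used here). [FriedliVelenik2017]
-/

noncomputable section

open Finset Filter Topology Set MeasureTheory intervalIntegral
open scoped BigOperators

namespace Literature.Probability.LatticeModels

variable {P : Type*} [DecidableEq P] {inc : P → P → Prop} [DecidableRel inc]

/-! ### Step 1: the Möbius–exponential bound -/

section MoebiusBound

/-- `‖e^z - 1‖ ≤ e^{‖z‖} - 1`. [folklore] -/
theorem norm_cexp_sub_one_le_exp_norm_sub_one (z : ℂ) : ‖Complex.exp z - 1‖ ≤ Real.exp ‖z‖ - 1 := by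
  have h := Complex.norm_exp_sub_sum_le_exp_norm_sub_sum z 1
  simpa using h

/-- For `y ≥ 1`: `1 + y (eˣ - 1) ≤ e^{y x}` (Bernoulli's inequality for the real power `(eˣ)^y`).
[folklore] -/
theorem one_add_mul_exp_sub_one_le (x : ℝ) {y : ℝ} (hy : 1 ≤ y) :
    1 + y * (Real.exp x - 1) ≤ Real.exp (y * x) := by
  have hs : -1 ≤ Real.exp x - 1 := by linarith [Real.exp_pos x]
  have h := one_add_mul_self_le_rpow_one_add hs hy
  rw [add_sub_cancel, ← Real.exp_mul] at h
  rwa [mul_comm y x]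

/-- Sums of a nonnegative function over a union are at most the sum of the sums. [folklore] -/
theorem sum_union_le_of_nonneg {β : Type*} [DecidableEq β] (s t : Finset β) (f : β → ℝ)
    (hf : ∀ b, 0 ≤ f b) : ∑ b ∈ s ∪ t, f b ≤ ∑ b ∈ s, f b + ∑ b ∈ t, f b := by
  have h := Finset.sum_union_inter (s₁ := s) (s₂ := t) (f := f)
  have h2 : 0 ≤ ∑ b ∈ s ∩ t, f b := Finset.sum_nonneg fun b _ => hf b
  linarith

/-- Sums of a nonnegative function over a `biUnion` are at most the sum of the sums over the
parts. [folklore] -/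
theorem sum_biUnion_le_sum_of_nonneg {ι β : Type*} [DecidableEq β] (S : Finset ι) (t : ι → Finset β)
    (f : β → ℝ) (hf : ∀ b, 0 ≤ f b) :
    ∑ b ∈ S.biUnion t, f b ≤ ∑ i ∈ S, ∑ b ∈ t i, f b := by
  classical
  induction S using Finset.induction_on with
  | empty => simp
  | insert i S hi ih =>
    rw [Finset.biUnion_insert, Finset.sum_insert hi]
    exact (sum_union_le_of_nonneg _ _ f hf).trans (by linarith)

/-- **Möbius transform of an up-set indicator**: `Σ_{B ⊆ C} (-1)^{|C ∖ B|} 1[U ⊆ B] = 1[U = C]`.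
[folklore] -/
theorem sum_powerset_neg_one_pow_card_sdiff_ite_subset {M : Type*} [CommRing M] (U C : Finset P) :
    ∑ B ∈ C.powerset, (-1 : M) ^ (C \ B).card * (if U ⊆ B then 1 else 0) =
      if U = C then 1 else 0 := by
  by_cases hUC : U ⊆ C
  · -- reindex `B = U ∪ T`, `T ⊆ C \ U`
    have hre : ∑ B ∈ C.powerset, (-1 : M) ^ (C \ B).card * (if U ⊆ B then 1 else 0) =
        ∑ T ∈ (C \ U).powerset, (-1 : M) ^ ((C \ U) \ T).card := by
      simp_rw [mul_boole]
      rw [← Finset.sum_filter]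
      have hset : C.powerset.filter (fun B => U ⊆ B) = (C \ U).powerset.image fun T => U ∪ T := by
        ext B
        simp only [Finset.mem_filter, Finset.mem_powerset, Finset.mem_image]
        constructor
        · rintro ⟨hBC, hUB⟩
          exact ⟨B \ U, Finset.sdiff_subset_sdiff hBC Finset.Subset.rfl,
            Finset.union_sdiff_of_subset hUB⟩
        · rintro ⟨T, hT, rfl⟩
          exact ⟨Finset.union_subset hUC (hT.trans Finset.sdiff_subset), Finset.subset_union_left⟩
      rw [hset, Finset.sum_image]
      · refine Finset.sum_congr rfl fun T hT => ?_
        have hT' : T ⊆ C \ U := Finset.mem_powerset.1 hT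
        congr 2
        rw [sdiff_sdiff_left, Finset.sup_eq_union]
      · intro T₁ hT₁ T₂ hT₂ h
        have h1 : Disjoint U T₁ :=
          Finset.disjoint_of_subset_right (Finset.mem_powerset.1 hT₁) Finset.disjoint_sdiff
        have h2 : Disjoint U T₂ :=
          Finset.disjoint_of_subset_right (Finset.mem_powerset.1 hT₂) Finset.disjoint_sdiff
        rw [← Finset.union_sdiff_cancel_left h1, ← Finset.union_sdiff_cancel_left h2]
        exact congrArg (· \ U) h
    rw [hre]
    have h := Finset.sum_pow_mul_eq_add_pow (1 : M) (-1) (C \ U)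
    simp only [one_pow, one_mul, add_neg_cancel] at h
    rw [Finset.sum_congr rfl fun T hT => by
      rw [Finset.card_sdiff_of_subset (Finset.mem_powerset.1 hT)], h]
    by_cases hUC' : U = C
    · subst hUC'
      simp
    · have hne : (C \ U).card ≠ 0 := by
        rw [Ne, Finset.card_eq_zero, Finset.sdiff_eq_empty_iff_subset]
        exact fun h => hUC' (Finset.Subset.antisymm hUC h)
      rw [zero_pow hne, if_neg hUC']
  · have hUC' : U ≠ C := fun h => hUC (h ▸ Finset.Subset.rfl)
    rw [if_neg hUC']
    refine Finset.sum_eq_zero fun B hB => ?_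
    rw [if_neg (fun h => hUC (h.trans (Finset.mem_powerset.1 hB))), mul_zero]

/-- The "support" of a family of sets of polymers marked at `δ`: `{δ} ∪ ⋃ 𝒟`. [folklore] -/
def markedSupport (δ : P) (𝒟 : Finset (Finset P)) : Finset P := insert δ (𝒟.biUnion id)

/-- **Expansion of the exponential of a restricted sum** (step towards [KP86, p. 497]): for
`δ ∈ B ⊆ L` and `𝒯 = {D ⊆ L : T D}`,
`exp(-Σ_{D ⊆ B, T D} g(D)) = Σ_{𝒟 ⊆ 𝒯} 1[{δ} ∪ ⋃𝒟 ⊆ B] Π_{D ∈ 𝒟} (e^{-g(D)} - 1)`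
(write `e^{-g} = 1 + h` and expand the product, `Finset.prod_one_add`); for `δ ∉ B` both sides of
the displayed identity, multiplied by `1[δ ∈ B]`, vanish. [folklore] -/
theorem ite_mem_mul_cexp_neg_sum_eq (g : Finset P → ℂ) (T : Finset P → Prop) [DecidablePred T]
    {L B : Finset P} (hB : B ⊆ L) (δ : P) :
    (if δ ∈ B then Complex.exp (-∑ D ∈ B.powerset with T D, g D) else 0) =
      ∑ 𝒟 ∈ (L.powerset.filter T).powerset,
        if markedSupport δ 𝒟 ⊆ B then ∏ D ∈ 𝒟, (Complex.exp (-g D) - 1) else 0 := by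
  by_cases hδ : δ ∈ B
  · rw [if_pos hδ, ← Finset.sum_neg_distrib, Complex.exp_sum]
    have h1 : ∏ D ∈ B.powerset.filter T, Complex.exp (-g D) =
        ∏ D ∈ B.powerset.filter T, (1 + (Complex.exp (-g D) - 1)) :=
      Finset.prod_congr rfl fun D _ => by ring
    rw [h1, Finset.prod_one_add, ← Finset.sum_filter]
    refine Finset.sum_congr ?_ fun 𝒟 _ => rfl
    ext 𝒟
    simp only [Finset.mem_powerset, Finset.mem_filter, markedSupport, Finset.insert_subset_iff,
      Finset.biUnion_subset, id]
    constructor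
    · intro h
      refine ⟨fun D hD => ?_, hδ, fun D hD => ?_⟩
      · have := Finset.mem_filter.1 (h hD)
        exact Finset.mem_filter.2 ⟨Finset.mem_powerset.2 ((Finset.mem_powerset.1 this.1).trans hB), this.2⟩
      · exact Finset.mem_powerset.1 (Finset.mem_filter.1 (h hD)).1
    · rintro ⟨h1, -, h3⟩ D hD
      exact Finset.mem_filter.2 ⟨Finset.mem_powerset.2 (h3 D hD), (Finset.mem_filter.1 (h1 hD)).2⟩
  · rw [if_neg hδ]
    symm
    refine Finset.sum_eq_zero fun 𝒟 _ => ?_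
    rw [if_neg]
    exact fun h => hδ (h (Finset.mem_insert_self δ _))

/-- **Möbius extraction of the marked supports**: for `C ⊆ L`,
`Σ_{B ⊆ C} (-1)^{|C∖B|} 1[δ ∈ B] exp(-Σ_{D ⊆ B, T D} g(D)) = Σ_{𝒟 ⊆ 𝒯 : {δ} ∪ ⋃𝒟 = C} Π_{D∈𝒟}(e^{-g(D)} - 1)`.
[folklore] -/
theorem moebius_ite_mem_mul_cexp_eq (g : Finset P → ℂ) (T : Finset P → Prop) [DecidablePred T]
    {L C : Finset P} (hC : C ⊆ L) (δ : P) :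
    ∑ B ∈ C.powerset, (-1 : ℂ) ^ (C \ B).card *
        (if δ ∈ B then Complex.exp (-∑ D ∈ B.powerset with T D, g D) else 0) =
      ∑ 𝒟 ∈ (L.powerset.filter T).powerset,
        if markedSupport δ 𝒟 = C then ∏ D ∈ 𝒟, (Complex.exp (-g D) - 1) else 0 := by
  rw [Finset.sum_congr rfl fun B hB => by
    rw [ite_mem_mul_cexp_neg_sum_eq g T ((Finset.mem_powerset.1 hB).trans hC) δ, Finset.mul_sum]]
  rw [Finset.sum_comm]
  refine Finset.sum_congr rfl fun 𝒟 _ => ?_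
  have key := sum_powerset_neg_one_pow_card_sdiff_ite_subset (M := ℂ) (markedSupport δ 𝒟) C
  calc ∑ B ∈ C.powerset, (-1 : ℂ) ^ (C \ B).card *
        (if markedSupport δ 𝒟 ⊆ B then ∏ D ∈ 𝒟, (Complex.exp (-g D) - 1) else 0)
      = (∏ D ∈ 𝒟, (Complex.exp (-g D) - 1)) * ∑ B ∈ C.powerset, (-1 : ℂ) ^ (C \ B).card *
          (if markedSupport δ 𝒟 ⊆ B then 1 else 0) := by
        rw [Finset.mul_sum]
        refine Finset.sum_congr rfl fun B _ => ?_
        split_ifs <;> ring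
    _ = if markedSupport δ 𝒟 = C then ∏ D ∈ 𝒟, (Complex.exp (-g D) - 1) else 0 := by
        rw [key]
        split_ifs <;> simp

/-- Norm bound for the Möbius-extracted sum: only the families with marked support `C`
contribute, each by at most the product of the norms. [folklore] -/
theorem norm_moebius_ite_mem_mul_cexp_le (g : Finset P → ℂ) (T : Finset P → Prop) [DecidablePred T]
    {L C : Finset P} (hC : C ⊆ L) (δ : P) :
    ‖∑ B ∈ C.powerset, (-1 : ℂ) ^ (C \ B).card *
        (if δ ∈ B then Complex.exp (-∑ D ∈ B.powerset with T D, g D) else 0)‖ ≤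
      ∑ 𝒟 ∈ (L.powerset.filter T).powerset,
        if markedSupport δ 𝒟 = C then ∏ D ∈ 𝒟, ‖Complex.exp (-g D) - 1‖ else 0 := by
  rw [moebius_ite_mem_mul_cexp_eq g T hC δ]
  refine (norm_sum_le _ _).trans (Finset.sum_le_sum fun 𝒟 _ => ?_)
  split_ifs
  · exact Finset.norm_prod_le _ _
  · simp

/-- The size of a marked support is at most `d(δ)` plus the sizes of the members (`d ≥ 0`).
[folklore] -/
theorem sum_markedSupport_le {d : P → ℝ} (hd : ∀ γ, 0 ≤ d γ) (δ : P) (𝒟 : Finset (Finset P)) :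
    ∑ γ ∈ markedSupport δ 𝒟, d γ ≤ d δ + ∑ D ∈ 𝒟, ∑ γ ∈ D, d γ := by
  unfold markedSupport
  rw [Finset.insert_eq]
  refine (sum_union_le_of_nonneg _ _ d hd).trans ?_
  rw [Finset.sum_singleton]
  have h := sum_biUnion_le_sum_of_nonneg 𝒟 id d hd
  simp only [id] at h
  linarith

/-- **The Möbius–exponential bound** (the estimate behind [KP86, p. 497]): for `d ≥ 0`, any
`g : Finset P → ℂ`, any selection `T` of "touching" sets and any `δ`,
`Σ_{C ⊆ L} e^{d(C)} |Σ_{B ⊆ C} (-1)^{|C∖B|} 1[δ∈B] exp(-Σ_{D ⊆ B, T D} g(D))| ≤ e^{d(δ)} exp(Σ_{D ⊆ L, T D} |g(D)| e^{d(D)})`,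
where `d(C) = Σ_{γ ∈ C} d(γ)`: expand `e^{-g} = 1 + h`, extract the marked supports by Möbius
inversion, use `d({δ} ∪ ⋃𝒟) ≤ d(δ) + Σ d(D)`, resum the product and bound each factor by
`1 + e^{d}(e^{|g|} - 1) ≤ exp(e^{d}|g|)`. [cite: KoteckyPreiss1986, §3 p. 497 (estimate of the derivative of Σ |Φ_t^T(C)| e^{d(C)})] -/
theorem sum_exp_mul_norm_moebius_le (g : Finset P → ℂ) (T : Finset P → Prop) [DecidablePred T]
    {d : P → ℝ} (hd : ∀ γ, 0 ≤ d γ) (L : Finset P) (δ : P) :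
    ∑ C ∈ L.powerset, Real.exp (∑ γ ∈ C, d γ) *
        ‖∑ B ∈ C.powerset, (-1 : ℂ) ^ (C \ B).card *
            (if δ ∈ B then Complex.exp (-∑ D ∈ B.powerset with T D, g D) else 0)‖ ≤
      Real.exp (d δ) *
        Real.exp (∑ D ∈ L.powerset with T D, ‖g D‖ * Real.exp (∑ γ ∈ D, d γ)) := by
  set 𝒯 : Finset (Finset P) := L.powerset.filter T with h𝒯
  set nh : Finset P → ℝ := fun D => ‖Complex.exp (-g D) - 1‖ with hnh
  set dd : Finset P → ℝ := fun D => ∑ γ ∈ D, d γ with hdd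
  have hnh0 : ∀ D, 0 ≤ nh D := fun D => norm_nonneg _
  have hdd0 : ∀ D, 0 ≤ dd D := fun D => Finset.sum_nonneg fun γ _ => hd γ
  -- Step 1: Möbius extraction and exchange of sums
  have h1 : ∑ C ∈ L.powerset, Real.exp (dd C) *
        ‖∑ B ∈ C.powerset, (-1 : ℂ) ^ (C \ B).card *
            (if δ ∈ B then Complex.exp (-∑ D ∈ B.powerset with T D, g D) else 0)‖ ≤
      ∑ 𝒟 ∈ 𝒯.powerset, Real.exp (dd (markedSupport δ 𝒟)) * ∏ D ∈ 𝒟, nh D := by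
    calc ∑ C ∈ L.powerset, Real.exp (dd C) *
          ‖∑ B ∈ C.powerset, (-1 : ℂ) ^ (C \ B).card *
              (if δ ∈ B then Complex.exp (-∑ D ∈ B.powerset with T D, g D) else 0)‖
        ≤ ∑ C ∈ L.powerset, Real.exp (dd C) * ∑ 𝒟 ∈ 𝒯.powerset,
            (if markedSupport δ 𝒟 = C then ∏ D ∈ 𝒟, nh D else 0) :=
          Finset.sum_le_sum fun C hC => mul_le_mul_of_nonneg_left
            (norm_moebius_ite_mem_mul_cexp_le g T (Finset.mem_powerset.1 hC) δ) (Real.exp_nonneg _)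
      _ = ∑ 𝒟 ∈ 𝒯.powerset, ∑ C ∈ L.powerset,
            (if markedSupport δ 𝒟 = C then Real.exp (dd C) * ∏ D ∈ 𝒟, nh D else 0) := by
          rw [Finset.sum_comm]
          refine Finset.sum_congr rfl fun C _ => ?_
          rw [Finset.mul_sum]
          refine Finset.sum_congr rfl fun 𝒟 _ => ?_
          split_ifs <;> simp
      _ = ∑ 𝒟 ∈ 𝒯.powerset, (if markedSupport δ 𝒟 ∈ L.powerset then
            Real.exp (dd (markedSupport δ 𝒟)) * ∏ D ∈ 𝒟, nh D else 0) := by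
          refine Finset.sum_congr rfl fun 𝒟 _ => ?_
          rw [Finset.sum_ite_eq]
      _ ≤ ∑ 𝒟 ∈ 𝒯.powerset, Real.exp (dd (markedSupport δ 𝒟)) * ∏ D ∈ 𝒟, nh D := by
          refine Finset.sum_le_sum fun 𝒟 _ => ?_
          split_ifs
          · exact le_rfl
          · exact mul_nonneg (Real.exp_nonneg _) (Finset.prod_nonneg fun D _ => hnh0 D)
  -- Step 2: bound the size of the marked support and resum
  have h2 : ∑ 𝒟 ∈ 𝒯.powerset, Real.exp (dd (markedSupport δ 𝒟)) * ∏ D ∈ 𝒟, nh D ≤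
      Real.exp (d δ) * ∏ D ∈ 𝒯, (1 + Real.exp (dd D) * nh D) := by
    rw [Finset.prod_one_add, Finset.mul_sum]
    refine Finset.sum_le_sum fun 𝒟 _ => ?_
    have hsz : Real.exp (dd (markedSupport δ 𝒟)) ≤ Real.exp (d δ) * ∏ D ∈ 𝒟, Real.exp (dd D) := by
      rw [← Real.exp_sum, ← Real.exp_add]
      exact Real.exp_le_exp.2 (sum_markedSupport_le hd δ 𝒟)
    calc Real.exp (dd (markedSupport δ 𝒟)) * ∏ D ∈ 𝒟, nh D
        ≤ (Real.exp (d δ) * ∏ D ∈ 𝒟, Real.exp (dd D)) * ∏ D ∈ 𝒟, nh D :=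
          mul_le_mul_of_nonneg_right hsz (Finset.prod_nonneg fun D _ => hnh0 D)
      _ = Real.exp (d δ) * ∏ D ∈ 𝒟, (Real.exp (dd D) * nh D) := by
          rw [mul_assoc, Finset.prod_mul_distrib]
  -- Step 3: factorwise exponential bound
  have h3 : ∏ D ∈ 𝒯, (1 + Real.exp (dd D) * nh D) ≤ ∏ D ∈ 𝒯, Real.exp (Real.exp (dd D) * ‖g D‖) := by
    refine Finset.prod_le_prod (fun D _ => ?_) fun D _ => ?_
    · exact add_nonneg zero_le_one (mul_nonneg (Real.exp_nonneg _) (hnh0 D))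
    · have hy : 1 ≤ Real.exp (dd D) := Real.one_le_exp (hdd0 D)
      have hh : nh D ≤ Real.exp ‖g D‖ - 1 := by
        have := norm_cexp_sub_one_le_exp_norm_sub_one (-g D)
        rwa [norm_neg] at this
      calc 1 + Real.exp (dd D) * nh D ≤ 1 + Real.exp (dd D) * (Real.exp ‖g D‖ - 1) := by
            gcongr
        _ ≤ Real.exp (Real.exp (dd D) * ‖g D‖) := one_add_mul_exp_sub_one_le _ hy
  calc _ ≤ _ := h1
    _ ≤ _ := h2
    _ ≤ Real.exp (d δ) * ∏ D ∈ 𝒯, Real.exp (Real.exp (dd D) * ‖g D‖) :=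
        mul_le_mul_of_nonneg_left h3 (Real.exp_nonneg _)
    _ = Real.exp (d δ) * Real.exp (∑ D ∈ 𝒯, ‖g D‖ * Real.exp (dd D)) := by
        rw [Real.exp_sum]
        congr 1
        exact Finset.prod_congr rfl fun D _ => by rw [mul_comm]

end MoebiusBound


/-! ### Steps 2–3: the derivative bound and the real induction in a finite volume -/

section KPInduction

variable [Std.Refl inc] [Std.Symm inc]

/-- `C ι γ` is decidable for a finite set `C` and a decidable incompatibility. [folklore] -/
instance instDecidableKPTouches (C : Finset P) (γ : P) : Decidable (KPTouches inc C γ) := by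
  unfold KPTouches; infer_instance

variable (inc) in
/-- The left-hand side of the Kotecký–Preiss estimate (4) in the finite volume `L`:
`Σ_{C ⊆ L, C ι γ} |Φ^T(C)| e^{d(C)}` (the quantity bounded by `a(γ)` in the statement `(S)` of
[KP86, §3]). [cite: KoteckyPreiss1986, §3 (S)] -/
def touchSum (v : P → ℂ) (d : P → ℝ) (L : Finset P) (γ : P) : ℝ :=
  ∑ C ∈ L.powerset with KPTouches inc C γ, ‖truncatedWeight inc v C‖ * Real.exp (∑ γ' ∈ C, d γ')

omit [Std.Refl inc] [Std.Symm inc] in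
/-- `touchSum ≥ 0`. [folklore] -/
theorem touchSum_nonneg (v : P → ℂ) (d : P → ℝ) (L : Finset P) (γ : P) :
    0 ≤ touchSum inc v d L γ :=
  Finset.sum_nonneg fun _ _ => mul_nonneg (norm_nonneg _) (Real.exp_nonneg _)

/-- The unit cube of multipliers. [folklore] -/
def multCube (P : Type*) (s : ℝ) : Set (P → ℝ) := Set.univ.pi fun _ => Set.Icc 0 s

omit [DecidableEq P] [DecidableRel inc] [Std.Refl inc] [Std.Symm inc] in
/-- Membership in the cube of multipliers. [folklore] -/
theorem mem_multCube {s : ℝ} {c : P → ℝ} : c ∈ multCube P s ↔ ∀ δ, c δ ∈ Set.Icc 0 s := by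
  rw [multCube, Set.mem_univ_pi]

/-- **The derivative bound** ([KP86, (12) and p. 497]). Let `L` be a KP volume for `w`, `c` multipliers
in `[0,1]`, `γ` a polymer, and suppose that along the whole partial-scaling path `Φ_t`
(`t ∈ [0,1]`, activities of the polymers incompatible with `γ` multiplied by `t`) the statement
`(S)` holds at every `δ ∈ L` incompatible with `γ`: `touchSum(Φ_t, δ) ≤ a(δ)`. Then
`Σ_{C ⊆ L, C ι γ} |Φ^T(C; Φ₁)| e^{d(C)} ≤ Σ_{δ ∈ L, δ ι γ} |Φ₁(δ)| e^{a(δ) + d(δ)}`.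
Proof: `Φ^T(C; Φ₀) = 0` (11); `Φ^T(C;Φ₁) = ∫₀¹ Σ_{B ⊆ C} (-1)^{|C∖B|} Ż_t(B)/Z_t(B) dt` by the
log-increment identity; `Ż_t(B)/Z_t(B) = Σ_{δ ∈ B, δ ι γ} Φ(δ) exp(-Σ_{D ⊆ B, D ι δ} Φ_t^T(D))`
by the chain rule and (5); the Möbius–exponential bound and `(S)` for `Φ_t` give the integrand
bound `Σ_{δ ι γ} |Φ(δ)| e^{d(δ)} e^{a(δ)}`. [cite: KoteckyPreiss1986, §3 (12) and p. 497 (derivative of log 𝒵(B; Φ_t))] -/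
theorem touchSum_le_of_forall_scaleAt {w : P → ℂ} {a d : P → ℝ} (hd : ∀ γ, 0 ≤ d γ)
    {L : Finset P} (hKP : IsKPVolume inc w a L) {c : P → ℝ} (hc : ∀ δ, c δ ∈ Set.Icc (0 : ℝ) 1)
    {γ : P}
    (hS : ∀ t ∈ Set.Icc (0 : ℝ) 1, ∀ δ ∈ L, inc δ γ →
      touchSum inc (scaledActivity w (scaleAt inc c γ t)) d L δ ≤ a δ) :
    touchSum inc (scaledActivity w c) d L γ ≤
      ∑ δ ∈ L with inc δ γ, ‖scaledActivity w c δ‖ * Real.exp (a δ + d δ) := by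
  -- notation: the path, the partition functions along it and their derivatives
  set v : ℝ → P → ℂ := fun t => scaledActivity w (scaleAt inc c γ t) with hv
  have hv1 : v 1 = scaledActivity w c := by simp [hv]
  set ζ : Finset P → ℝ → ℂ := fun B t => polymerPartitionFunction inc (v t) B with hζ
  set ζ' : Finset P → ℝ → ℂ := fun B t => ∑ δ ∈ B with inc δ γ,
    scaledActivity w c δ * polymerPartitionFunction inc (v t) (B.filter fun γ' => ¬ inc γ' δ) with hζ'
  have hct : ∀ t ∈ Set.Icc (0 : ℝ) 1, ∀ δ, scaleAt inc c γ t δ ∈ Set.Icc (0 : ℝ) 1 :=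
    fun t ht δ => scaleAt_mem_Icc hc γ ht δ
  have hKPt : ∀ t ∈ Set.Icc (0 : ℝ) 1, IsKPVolume inc (v t) a L := fun t ht =>
    isKPVolume_scaled hKP (hct t ht)
  -- (a) derivative, (b) zero-freeness, (c) continuity of `ζ'`, (d) `exp log = Z`, (e) continuity of `log`
  have hderiv : ∀ B t, HasDerivAt (ζ B) (ζ' B t) t := fun B t =>
    hasDerivAt_polymerPartitionFunction_scaleAt w c γ B t
  have hne : ∀ B ⊆ L, ∀ t ∈ Set.Icc (0 : ℝ) 1, ζ B t ≠ 0 := fun B hB t ht =>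
    polymerPartitionFunction_ne_zero_of_kp (hKPt t ht) hB
  have hζ'c : ∀ B, Continuous (ζ' B) := by
    intro B
    simp only [hζ', hv]
    refine continuous_finsetSum _ fun δ _ => continuous_const.mul ?_
    exact (continuous_polymerPartitionFunction_scaledActivity inc w _).comp (continuous_scaleAt c γ)
  have hζc : ∀ B, Continuous (ζ B) := fun B =>
    continuous_iff_continuousAt.2 fun t => (hderiv B t).continuousAt
  have hexp : ∀ B ⊆ L, ∀ t ∈ Set.Icc (0 : ℝ) 1,
      Complex.exp (polymerLogZ inc (v t) B) = ζ B t := fun B hB t ht =>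
    exp_polymerLogZ_of_kp (hKPt t ht) hB
  have hcube : ∀ c' ∈ multCube P 1, ∀ B ⊆ L, ∀ u ∈ Set.Icc (0 : ℝ) 1,
      polymerPartitionFunction inc (fun δ => (u : ℂ) * scaledActivity w c' δ) B ≠ 0 :=
    fun c' hc' B hB u hu => polymerPartitionFunction_scaled_ne_zero_of_kp hKP hB (mem_multCube.1 hc') hu
  have hmaps : Set.MapsTo (fun t => scaleAt inc c γ t) (Set.Icc (0 : ℝ) 1) (multCube P 1) :=
    fun t ht => mem_multCube.2 (hct t ht)
  have hlogc : ∀ B ⊆ L, ContinuousOn (fun t => polymerLogZ inc (v t) B) (Set.Icc 0 1) := by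
    intro B hB
    have h := (continuousOn_polymerLogZ_scaled (inc := inc) w B
      (fun c' hc' u hu => hcube c' hc' B hB u hu)).comp (continuous_scaleAt c γ).continuousOn hmaps
    exact h
  -- (f) the log-increment identity on each `B ⊆ L`
  have hincr : ∀ B ⊆ L, ∫ t in (0 : ℝ)..1, ζ' B t / ζ B t =
      polymerLogZ inc (v 1) B - polymerLogZ inc (v 0) B := fun B hB =>
    integral_div_eq_sub_of_exp_eq zero_le_one (hlogc B hB) (fun t _ => hderiv B t)
      (hζ'c B).continuousOn (hne B hB) (hexp B hB)
  -- (g) vanishing at `t = 0` ([KP86, (11)])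
  have hzero : ∀ C, KPTouches inc C γ → truncatedWeight inc (v 0) C = 0 := fun C hC =>
    truncatedWeight_eq_zero_of_forall_inc_eq_zero hC fun δ _ hδ =>
      scaledActivity_scaleAt_zero_of_inc w c hδ
  -- the integrand `f C t = Σ_{B ⊆ C} (-1)^{|C∖B|} Ż_t(B)/Z_t(B)`
  set f : Finset P → ℝ → ℂ := fun C t =>
    ∑ B ∈ C.powerset, (-1 : ℂ) ^ (C \ B).card * (ζ' B t / ζ B t) with hf
  have hfBc : ∀ C ⊆ L, ∀ B ∈ C.powerset,
      ContinuousOn (fun t => (-1 : ℂ) ^ (C \ B).card * (ζ' B t / ζ B t)) (Set.uIcc 0 1) := by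
    intro C hC B hB
    have hBL : B ⊆ L := (Finset.mem_powerset.1 hB).trans hC
    rw [Set.uIcc_of_le zero_le_one]
    exact continuousOn_const.mul ((hζ'c B).continuousOn.div (hζc B).continuousOn (hne B hBL))
  have hfc : ∀ C ⊆ L, ContinuousOn (f C) (Set.uIcc 0 1) := fun C hC =>
    continuousOn_finsetSum _ fun B hB => hfBc C hC B hB
  -- (h) `Φ^T(C; Φ₁) = ∫₀¹ f C`
  have hrep : ∀ C ⊆ L, KPTouches inc C γ →
      truncatedWeight inc (v 1) C = ∫ t in (0 : ℝ)..1, f C t := by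
    intro C hC hCγ
    rw [show truncatedWeight inc (v 1) C = truncatedWeight inc (v 1) C - truncatedWeight inc (v 0) C by
      rw [hzero C hCγ, sub_zero]]
    simp only [hf]
    rw [intervalIntegral.integral_finsetSum fun B hB => (hfBc C hC B hB).intervalIntegrable]
    unfold truncatedWeight
    rw [← Finset.sum_sub_distrib]
    refine Finset.sum_congr rfl fun B hB => ?_
    have hBL : B ⊆ L := (Finset.mem_powerset.1 hB).trans hC
    rw [← mul_sub, ← hincr B hBL, intervalIntegral.integral_const_mul]
  -- (i) the ratio `Z(B∖[δ])/Z(B)` through clusters ([KP86, (5)])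
  have hratio : ∀ B ⊆ L, ∀ t ∈ Set.Icc (0 : ℝ) 1, ∀ δ : P,
      polymerPartitionFunction inc (v t) (B.filter fun γ' => ¬ inc γ' δ) / ζ B t =
        Complex.exp (-∑ D ∈ B.powerset with KPTouches inc D δ, truncatedWeight inc (v t) D) := by
    intro B hB t ht δ
    have h5 := polymerPartitionFunction_sdiff_div_eq_exp (inc := inc) (w := v t) (a := a) (Λ := B)
      (D := B.filter fun γ' => inc γ' δ) ((hKPt t ht).mono hB)
    rw [sdiff_filter_inc_eq] at h5
    simp only [hζ]
    rw [h5]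
    congr 2
    refine Finset.sum_congr (Finset.filter_congr fun D hD => ?_) fun _ _ => rfl
    have hDB : D ⊆ B := Finset.mem_powerset.1 hD
    constructor
    · rintro ⟨x, hx⟩
      rw [Finset.mem_inter, Finset.mem_filter] at hx
      exact ⟨x, hx.1, hx.2.2⟩
    · rintro ⟨x, hxD, hx⟩
      exact ⟨x, Finset.mem_inter.2 ⟨hxD, Finset.mem_filter.2 ⟨hDB hxD, hx⟩⟩⟩
  -- the Möbius-extracted exponential
  set Mo : P → ℝ → Finset P → ℂ := fun δ t C => ∑ B ∈ C.powerset, (-1 : ℂ) ^ (C \ B).card *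
    (if δ ∈ B then Complex.exp (-∑ D ∈ B.powerset with KPTouches inc D δ,
      truncatedWeight inc (v t) D) else 0) with hMo
  -- (i') pointwise identity `f C t = Σ_{δ ∈ C, δ ι γ} Φ(δ) Mo δ t C`
  have hfC : ∀ C ⊆ L, ∀ t ∈ Set.Icc (0 : ℝ) 1,
      f C t = ∑ δ ∈ C with inc δ γ, scaledActivity w c δ * Mo δ t C := by
    intro C hC t ht
    have hB : ∀ B ∈ C.powerset, (-1 : ℂ) ^ (C \ B).card * (ζ' B t / ζ B t) =
        ∑ δ ∈ C with inc δ γ, scaledActivity w c δ * ((-1 : ℂ) ^ (C \ B).card *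
          (if δ ∈ B then Complex.exp (-∑ D ∈ B.powerset with KPTouches inc D δ,
            truncatedWeight inc (v t) D) else 0)) := by
      intro B hB
      have hBC : B ⊆ C := Finset.mem_powerset.1 hB
      have hBL : B ⊆ L := hBC.trans hC
      have h1 : ζ' B t / ζ B t = ∑ δ ∈ B with inc δ γ, scaledActivity w c δ *
          Complex.exp (-∑ D ∈ B.powerset with KPTouches inc D δ, truncatedWeight inc (v t) D) := by
        simp only [hζ']
        rw [Finset.sum_div]
        refine Finset.sum_congr rfl fun δ _ => ?_
        rw [mul_div_assoc, hratio B hBL t ht δ]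
      have h2 : ∑ δ ∈ B with inc δ γ, scaledActivity w c δ *
          Complex.exp (-∑ D ∈ B.powerset with KPTouches inc D δ, truncatedWeight inc (v t) D) =
          ∑ δ ∈ C with inc δ γ, scaledActivity w c δ *
            (if δ ∈ B then Complex.exp (-∑ D ∈ B.powerset with KPTouches inc D δ,
              truncatedWeight inc (v t) D) else 0) := by
        have hset : (C.filter fun δ => inc δ γ) ∩ B = B.filter fun δ => inc δ γ := by
          ext δ
          simp only [Finset.mem_inter, Finset.mem_filter]
          constructor
          · rintro ⟨⟨-, h1⟩, h2⟩; exact ⟨h2, h1⟩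
          · rintro ⟨h1, h2⟩; exact ⟨⟨hBC h1, h2⟩, h1⟩
        rw [← hset, ← Finset.sum_ite_mem]
        refine Finset.sum_congr rfl fun δ _ => ?_
        split_ifs <;> simp
      rw [h1, h2, Finset.mul_sum]
      refine Finset.sum_congr rfl fun δ _ => ?_
      split_ifs <;> ring
    simp only [hf, hMo]
    rw [Finset.sum_congr rfl hB, Finset.sum_comm]
    refine Finset.sum_congr rfl fun δ _ => ?_
    rw [Finset.mul_sum]
  -- (j) pointwise bound on the weighted sum of the integrands, via the Möbius–exponential bound
  set K : ℝ := ∑ δ ∈ L with inc δ γ, ‖scaledActivity w c δ‖ * Real.exp (a δ + d δ) with hK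
  have hpt : ∀ t ∈ Set.Icc (0 : ℝ) 1,
      ∑ C ∈ L.powerset with KPTouches inc C γ, ‖f C t‖ * Real.exp (∑ γ' ∈ C, d γ') ≤ K := by
    intro t ht
    -- norm bound for each `C`
    have hnC : ∀ C ∈ L.powerset.filter (fun C => KPTouches inc C γ),
        ‖f C t‖ * Real.exp (∑ γ' ∈ C, d γ') ≤
          ∑ δ ∈ L with inc δ γ, ‖scaledActivity w c δ‖ * (Real.exp (∑ γ' ∈ C, d γ') * ‖Mo δ t C‖) := by
      intro C hC
      have hCL : C ⊆ L := Finset.mem_powerset.1 (Finset.mem_filter.1 hC).1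
      rw [hfC C hCL t ht]
      calc ‖∑ δ ∈ C with inc δ γ, scaledActivity w c δ * Mo δ t C‖ * Real.exp (∑ γ' ∈ C, d γ')
          ≤ (∑ δ ∈ C with inc δ γ, ‖scaledActivity w c δ‖ * ‖Mo δ t C‖) * Real.exp (∑ γ' ∈ C, d γ') := by
            refine mul_le_mul_of_nonneg_right ((norm_sum_le _ _).trans (le_of_eq ?_)) (Real.exp_nonneg _)
            exact Finset.sum_congr rfl fun δ _ => norm_mul _ _
        _ ≤ (∑ δ ∈ L with inc δ γ, ‖scaledActivity w c δ‖ * ‖Mo δ t C‖) * Real.exp (∑ γ' ∈ C, d γ') := by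
            refine mul_le_mul_of_nonneg_right (Finset.sum_le_sum_of_subset_of_nonneg
              (Finset.filter_subset_filter _ hCL) fun δ _ _ => ?_) (Real.exp_nonneg _)
            exact mul_nonneg (norm_nonneg _) (norm_nonneg _)
        _ = ∑ δ ∈ L with inc δ γ, ‖scaledActivity w c δ‖ * (Real.exp (∑ γ' ∈ C, d γ') * ‖Mo δ t C‖) := by
            rw [Finset.sum_mul]
            exact Finset.sum_congr rfl fun δ _ => by ring
    calc ∑ C ∈ L.powerset with KPTouches inc C γ, ‖f C t‖ * Real.exp (∑ γ' ∈ C, d γ')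
        ≤ ∑ C ∈ L.powerset with KPTouches inc C γ, ∑ δ ∈ L with inc δ γ,
            ‖scaledActivity w c δ‖ * (Real.exp (∑ γ' ∈ C, d γ') * ‖Mo δ t C‖) :=
          Finset.sum_le_sum hnC
      _ = ∑ δ ∈ L with inc δ γ, ‖scaledActivity w c δ‖ *
            ∑ C ∈ L.powerset with KPTouches inc C γ, Real.exp (∑ γ' ∈ C, d γ') * ‖Mo δ t C‖ := by
          rw [Finset.sum_comm]
          exact Finset.sum_congr rfl fun δ _ => by rw [Finset.mul_sum]
      _ ≤ ∑ δ ∈ L with inc δ γ, ‖scaledActivity w c δ‖ *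
            ∑ C ∈ L.powerset, Real.exp (∑ γ' ∈ C, d γ') * ‖Mo δ t C‖ := by
          refine Finset.sum_le_sum fun δ _ => mul_le_mul_of_nonneg_left ?_ (norm_nonneg _)
          exact Finset.sum_le_sum_of_subset_of_nonneg (Finset.filter_subset _ _)
            fun C _ _ => mul_nonneg (Real.exp_nonneg _) (norm_nonneg _)
      _ ≤ ∑ δ ∈ L with inc δ γ, ‖scaledActivity w c δ‖ *
            (Real.exp (d δ) * Real.exp (touchSum inc (v t) d L δ)) := by
          refine Finset.sum_le_sum fun δ _ => mul_le_mul_of_nonneg_left ?_ (norm_nonneg _)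
          exact sum_exp_mul_norm_moebius_le (truncatedWeight inc (v t)) (fun D => KPTouches inc D δ)
            hd L δ
      _ ≤ ∑ δ ∈ L with inc δ γ, ‖scaledActivity w c δ‖ * (Real.exp (d δ) * Real.exp (a δ)) := by
          refine Finset.sum_le_sum fun δ hδ => mul_le_mul_of_nonneg_left ?_ (norm_nonneg _)
          obtain ⟨hδL, hδγ⟩ := Finset.mem_filter.1 hδ
          exact mul_le_mul_of_nonneg_left (Real.exp_le_exp.2 (hS t ht δ hδL hδγ)) (Real.exp_nonneg _)
      _ = K := by
          simp only [hK]
          exact Finset.sum_congr rfl fun δ _ => by rw [Real.exp_add, mul_comm (Real.exp (a δ))]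
  -- (k) integrate
  have hint : ∀ C ∈ L.powerset.filter (fun C => KPTouches inc C γ),
      IntervalIntegrable (fun t => ‖f C t‖ * Real.exp (∑ γ' ∈ C, d γ')) MeasureTheory.volume 0 1 := by
    intro C hC
    have hCL : C ⊆ L := Finset.mem_powerset.1 (Finset.mem_filter.1 hC).1
    exact ((hfc C hCL).norm.mul continuousOn_const).intervalIntegrable
  rw [← hv1]
  calc touchSum inc (v 1) d L γ
      = ∑ C ∈ L.powerset with KPTouches inc C γ,
          ‖∫ t in (0 : ℝ)..1, f C t‖ * Real.exp (∑ γ' ∈ C, d γ') := by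
        unfold touchSum
        refine Finset.sum_congr rfl fun C hC => ?_
        obtain ⟨hCL, hCγ⟩ := Finset.mem_filter.1 hC
        rw [hrep C (Finset.mem_powerset.1 hCL) hCγ]
    _ ≤ ∑ C ∈ L.powerset with KPTouches inc C γ,
          (∫ t in (0 : ℝ)..1, ‖f C t‖) * Real.exp (∑ γ' ∈ C, d γ') :=
        Finset.sum_le_sum fun C _ => mul_le_mul_of_nonneg_right
          (intervalIntegral.norm_integral_le_integral_norm zero_le_one) (Real.exp_nonneg _)
    _ = ∑ C ∈ L.powerset with KPTouches inc C γ,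
          ∫ t in (0 : ℝ)..1, ‖f C t‖ * Real.exp (∑ γ' ∈ C, d γ') :=
        Finset.sum_congr rfl fun C _ => (intervalIntegral.integral_mul_const _ _).symm
    _ = ∫ t in (0 : ℝ)..1, ∑ C ∈ L.powerset with KPTouches inc C γ,
          ‖f C t‖ * Real.exp (∑ γ' ∈ C, d γ') :=
        (intervalIntegral.integral_finsetSum hint).symm
    _ ≤ ∫ _ in (0 : ℝ)..1, K := by
        refine intervalIntegral.integral_mono_on zero_le_one ?_ ?_ fun t ht => hpt t ht
        · have h := IntervalIntegrable.sum (L.powerset.filter fun C => KPTouches inc C γ) hint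
          rwa [Finset.sum_fn] at h
        · exact intervalIntegrable_const
    _ = K := by simp


omit [Std.Refl inc] [Std.Symm inc] [DecidableEq P] in
/-- Scalar multiples commute with the partial scaling. [folklore] -/
theorem scaleAt_smul (s : ℝ) (c : P → ℝ) (γ : P) (t : ℝ) :
    scaleAt inc (s • c) γ t = s • scaleAt inc c γ t := by
  funext δ
  simp only [scaleAt_apply, Pi.smul_apply, smul_eq_mul]
  split_ifs <;> ring

omit [Std.Refl inc] [Std.Symm inc] [DecidableEq P] [DecidableRel inc] in
/-- Scalar multiples `s • c`, `s ∈ [0,1]`, of multipliers in the unit cube stay in the unit cube.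
[folklore] -/
theorem smul_mem_multCube {s : ℝ} (hs : s ∈ Set.Icc (0 : ℝ) 1) {c : P → ℝ} (hc : c ∈ multCube P 1) :
    s • c ∈ multCube P 1 := by
  rw [mem_multCube] at hc ⊢
  intro δ
  exact ⟨mul_nonneg hs.1 (hc δ).1, mul_le_one₀ hs.2 (hc δ).1 (hc δ).2⟩

omit [Std.Refl inc] in
/-- `touchSum` vanishes when the activities of all polymers of `L` incompatible with `γ` vanish
([KP86, (11)]). [cite: KoteckyPreiss1986, §3 (11)] -/
theorem touchSum_eq_zero_of_forall_inc_eq_zero {v : P → ℂ} (d : P → ℝ) {L : Finset P} {γ : P}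
    (hv : ∀ δ ∈ L, inc δ γ → v δ = 0) : touchSum inc v d L γ = 0 := by
  unfold touchSum
  refine Finset.sum_eq_zero fun C hC => ?_
  obtain ⟨hCL, hCγ⟩ := Finset.mem_filter.1 hC
  rw [truncatedWeight_eq_zero_of_forall_inc_eq_zero hCγ fun δ hδ h =>
    hv δ (Finset.mem_powerset.1 hCL hδ) h, norm_zero, zero_mul]

/-- Continuity of `touchSum` in the multipliers on the unit cube, in a KP volume. [cite: KoteckyPreiss1986, §3 (continuity of Φ ↦ Σ |Φ^T(C)| e^{d(C)})] -/
theorem continuousOn_touchSum {w : P → ℂ} {a : P → ℝ} (d : P → ℝ) {L : Finset P}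
    (hKP : IsKPVolume inc w a L) (γ : P) :
    ContinuousOn (fun c => touchSum inc (scaledActivity w c) d L γ) (multCube P 1) := by
  unfold touchSum
  refine continuousOn_finsetSum _ fun C hC => ?_
  have hCL : C ⊆ L := Finset.mem_powerset.1 (Finset.mem_filter.1 hC).1
  refine (ContinuousOn.norm ?_).mul continuousOn_const
  exact continuousOn_truncatedWeight_scaled w C fun c hc B hB u hu =>
    polymerPartitionFunction_scaled_ne_zero_of_kp hKP (hB.trans hCL) (mem_multCube.1 hc) hu

/-- **The Kotecký–Preiss estimate in a finite volume, along the rays of the unit cube**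
([KP86, §3], statement `(S)` for all functionals `s·c·Φ`): if `a, d ≥ 0` and
`Σ_{γ' ∈ L, γ' ι γ} |w(γ')| e^{a(γ') + d(γ')} ≤ a(γ)` for all `γ ∈ L`, then for every `s ∈ [0,1]`,
every family of multipliers `c ∈ [0,1]^P` and every `γ ∈ L`,
`Σ_{C ⊆ L, C ι γ} |Φ^T(C; s·c·w)| e^{d(C)} ≤ a(γ)`.
Proof ("real induction" on `s`, [KP86, §3]): the set `I` of good `s` contains `0` ((11)), is
closed (continuity of `Φ^T` in the multipliers), and is open to the right: at `s ∈ I`, `s < 1`,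
the derivative bound gives the STRICT inequality `≤ s·a(γ)`, which propagates to `s₂ > s` by
continuity and compactness of the cube (tube lemma). [cite: KoteckyPreiss1986, Theorem p. 492, estimate (4); §3 (S), (9)–(12)] -/
theorem touchSum_smul_le_of_kp {w : P → ℂ} {a d : P → ℝ} (ha : ∀ γ, 0 ≤ a γ) (hd : ∀ γ, 0 ≤ d γ)
    {L : Finset P}
    (h1 : ∀ γ ∈ L, ∑ γ' ∈ L with inc γ' γ, ‖w γ'‖ * Real.exp (a γ' + d γ') ≤ a γ) :
    ∀ s ∈ Set.Icc (0 : ℝ) 1, ∀ c ∈ multCube P 1, ∀ γ ∈ L,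
      touchSum inc (scaledActivity w (s • c)) d L γ ≤ a γ := by
  -- the KP volume condition (drop `d ≥ 0`)
  have hKP : IsKPVolume inc w a L := fun γ hγ => by
    refine le_trans (Finset.sum_le_sum fun γ' _ => ?_) (h1 γ hγ)
    unfold kpTerm
    exact mul_le_mul_of_nonneg_left (Real.exp_le_exp.2 (le_add_of_nonneg_right (hd γ'))) (norm_nonneg _)
  -- `γ` with `a γ = 0`: everything incompatible with `γ` has zero activity
  have hzeroact : ∀ γ ∈ L, a γ = 0 → ∀ δ ∈ L, inc δ γ → w δ = 0 := by
    intro γ hγ haγ δ hδ hδγ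
    have hsum := h1 γ hγ
    rw [haγ] at hsum
    have hle : ‖w δ‖ * Real.exp (a δ + d δ) ≤ 0 := by
      refine le_trans ?_ hsum
      refine Finset.single_le_sum (f := fun γ' => ‖w γ'‖ * Real.exp (a γ' + d γ'))
        (fun γ' _ => mul_nonneg (norm_nonneg _) (Real.exp_nonneg _)) (Finset.mem_filter.2 ⟨hδ, hδγ⟩)
    have h0 : ‖w δ‖ ≤ 0 := by
      by_contra h
      have : 0 < ‖w δ‖ * Real.exp (a δ + d δ) := mul_pos (lt_of_not_ge h) (Real.exp_pos _)
      linarith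
    exact norm_le_zero_iff.1 h0
  -- notation
  set G : P → (P → ℝ) → ℝ := fun γ c => touchSum inc (scaledActivity w c) d L γ with hG
  set clamp : ℝ → ℝ := fun s => max 0 (min 1 s) with hclamp
  have hclampc : Continuous clamp := by simp only [hclamp]; fun_prop
  have hclamp_mem : ∀ s, clamp s ∈ Set.Icc (0 : ℝ) 1 := fun s =>
    ⟨le_max_left _ _, max_le zero_le_one (min_le_left _ _)⟩
  have hclamp_id : ∀ s ∈ Set.Icc (0 : ℝ) 1, clamp s = s := fun s hs => by
    simp only [hclamp]; rw [min_eq_right hs.2, max_eq_right hs.1]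
  set I : Set ℝ := {s | ∀ c ∈ multCube P 1, ∀ γ ∈ L, G γ (clamp s • c) ≤ a γ} with hI
  -- it suffices to show `[0,1] ⊆ I`
  suffices hmain : Set.Icc (0 : ℝ) 1 ⊆ I by
    intro s hs c hc γ hγ
    have := hmain hs c hc γ hγ
    rwa [hclamp_id s hs] at this
  have hGc : ∀ γ, ContinuousOn (G γ) (multCube P 1) := fun γ => continuousOn_touchSum d hKP γ
  refine IsClosed.Icc_subset_of_forall_mem_nhdsWithin ?_ ?_ ?_
  · -- closedness: `I` itself is closed
    refine IsClosed.inter ?_ isClosed_Icc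
    have hIeq : I = ⋂ c ∈ multCube P 1, ⋂ γ ∈ L, (fun s => G γ (clamp s • c)) ⁻¹' Set.Iic (a γ) := by
      ext s; simp [hI]
    rw [hIeq]
    refine isClosed_biInter fun c hc => isClosed_biInter fun γ _ => ?_
    refine IsClosed.preimage ?_ isClosed_Iic
    have hpath : Continuous fun s : ℝ => clamp s • c := hclampc.smul continuous_const
    exact (hGc γ).comp_continuous hpath fun s => smul_mem_multCube (hclamp_mem s) hc
  · -- `0 ∈ I`
    intro c _ γ _
    have h0 : clamp 0 = 0 := hclamp_id 0 ⟨le_rfl, zero_le_one⟩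
    rw [h0, zero_smul]
    simp only [hG]
    rw [touchSum_eq_zero_of_forall_inc_eq_zero d fun δ _ _ => by simp [scaledActivity]]
    exact ha γ
  · -- openness to the right
    rintro x ⟨hxI, hx0, hx1⟩
    have hxIcc : x ∈ Set.Icc (0 : ℝ) 1 := ⟨hx0, hx1.le⟩
    have hxclamp : clamp x = x := hclamp_id x hxIcc
    -- (S) at `x` for all multipliers in the cube
    have hSx : ∀ c ∈ multCube P 1, ∀ δ ∈ L, G δ (x • c) ≤ a δ := fun c hc δ hδ => by
      have := hxI c hc δ hδ; rwa [hxclamp] at this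
    -- strict inequality at `x` from the derivative bound
    have hstrict : ∀ c ∈ multCube P 1, ∀ γ ∈ L, G γ (x • c) ≤ x * a γ := by
      intro c hc γ hγ
      have hxc : ∀ δ, (x • c) δ ∈ Set.Icc (0 : ℝ) 1 := mem_multCube.1 (smul_mem_multCube hxIcc hc)
      have hD := touchSum_le_of_forall_scaleAt (inc := inc) hd hKP hxc (γ := γ) fun t ht δ hδ _ => by
        rw [scaleAt_smul]
        exact hSx _ (mem_multCube.2 (scaleAt_mem_Icc (mem_multCube.1 hc) γ ht)) δ hδ
      refine hD.trans ?_
      calc ∑ δ ∈ L with inc δ γ, ‖scaledActivity w (x • c) δ‖ * Real.exp (a δ + d δ)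
          ≤ ∑ δ ∈ L with inc δ γ, x * (‖w δ‖ * Real.exp (a δ + d δ)) := by
            refine Finset.sum_le_sum fun δ _ => ?_
            rw [norm_scaledActivity (hxc δ).1, Pi.smul_apply, smul_eq_mul, mul_assoc, mul_assoc]
            refine mul_le_mul_of_nonneg_left ?_ hx0
            exact mul_le_of_le_one_left (mul_nonneg (norm_nonneg _) (Real.exp_nonneg _))
              (mem_multCube.1 hc δ).2
        _ = x * ∑ δ ∈ L with inc δ γ, ‖w δ‖ * Real.exp (a δ + d δ) := by rw [Finset.mul_sum]
        _ ≤ x * a γ := mul_le_mul_of_nonneg_left (h1 γ hγ) hx0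
    -- for each `γ ∈ L`: eventually (near `x`) the bound holds for all multipliers
    have hev : ∀ γ ∈ L, ∀ᶠ s in 𝓝 x, s ∈ Set.Icc (0 : ℝ) 1 → ∀ c ∈ multCube P 1, G γ (s • c) ≤ a γ := by
      intro γ hγ
      rcases (ha γ).eq_or_lt with haγ | haγ
      · -- `a γ = 0`
        refine Eventually.of_forall fun s _ c _ => ?_
        simp only [hG]
        rw [touchSum_eq_zero_of_forall_inc_eq_zero d fun δ hδ hδγ => by
          rw [scaledActivity_apply, hzeroact γ hγ haγ.symm δ hδ hδγ, mul_zero]]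
        exact ha γ
      · -- `a γ > 0`: tube lemma around `{x} × cube`
        set D : Set (ℝ × (P → ℝ)) := Set.Icc (0 : ℝ) 1 ×ˢ multCube P 1 with hDdef
        set F : ℝ × (P → ℝ) → ℝ := fun p => G γ (p.1 • p.2) with hF
        have hFc : ContinuousOn F D := by
          refine (hGc γ).comp (continuous_fst.smul continuous_snd).continuousOn ?_
          rintro ⟨s, c⟩ ⟨hs, hc⟩
          exact smul_mem_multCube hs hc
        obtain ⟨U, hUo, hU⟩ := (continuousOn_iff'.1 hFc) (Set.Iio (a γ)) isOpen_Iio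
        have hsub : ({x} : Set ℝ) ×ˢ multCube P 1 ⊆ U := by
          rintro ⟨s, c⟩ ⟨hs, hc⟩
          rw [Set.mem_singleton_iff] at hs
          subst hs
          have hmem : (s, c) ∈ F ⁻¹' Set.Iio (a γ) ∩ D := by
            refine ⟨?_, hxIcc, hc⟩
            show G γ (s • c) < a γ
            exact (hstrict c hc γ hγ).trans_lt (by nlinarith)
          rw [hU] at hmem
          exact hmem.1
        obtain ⟨u, v, huo, -, hxu, hcv, huv⟩ := generalized_tube_lemma isCompact_singleton
          (isCompact_univ_pi fun _ => isCompact_Icc) hUo hsub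
        have hu : u ∈ 𝓝 x := huo.mem_nhds (hxu (Set.mem_singleton x))
        filter_upwards [hu] with s hs hsI c hc
        have hmem : (s, c) ∈ U ∩ D := ⟨huv (Set.mk_mem_prod hs (hcv hc)), hsI, hc⟩
        rw [← hU] at hmem
        exact le_of_lt hmem.1
    have hev' := (Filter.eventually_all_finset L).2 hev
    have hlt : ∀ᶠ s in 𝓝 x, s < 1 := eventually_lt_nhds hx1
    rw [mem_nhdsWithin_iff_exists_mem_nhds_inter]
    refine ⟨_, hev'.and hlt, ?_⟩
    rintro s ⟨⟨hs1, hs2⟩, hsx⟩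
    have hsIcc : s ∈ Set.Icc (0 : ℝ) 1 := ⟨hx0.trans (le_of_lt hsx), hs2.le⟩
    intro c hc γ hγ
    rw [hclamp_id s hsIcc]
    exact hs1 γ hγ hsIcc c hc

/-- **The Kotecký–Preiss estimate (4) in a finite volume** ([KP86, §3, statement (S)]): if
`a, d ≥ 0` and `Σ_{γ' ∈ L, γ' ι γ} |w(γ')| e^{a(γ')+d(γ')} ≤ a(γ)` for all `γ ∈ L`, then
`Σ_{C ⊆ L, C ι γ} |Φ^T(C)| e^{d(C)} ≤ a(γ)` for all `γ ∈ L`. [cite: KoteckyPreiss1986, §3 (S)] -/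
theorem touchSum_le_of_kp {w : P → ℂ} {a d : P → ℝ} (ha : ∀ γ, 0 ≤ a γ) (hd : ∀ γ, 0 ≤ d γ)
    {L : Finset P}
    (h1 : ∀ γ ∈ L, ∑ γ' ∈ L with inc γ' γ, ‖w γ'‖ * Real.exp (a γ' + d γ') ≤ a γ) {γ : P}
    (hγ : γ ∈ L) : touchSum inc w d L γ ≤ a γ := by
  have h := touchSum_smul_le_of_kp ha hd h1 1 ⟨zero_le_one, le_rfl⟩ (fun _ => 1)
    (mem_multCube.2 fun _ => ⟨zero_le_one, le_rfl⟩) γ hγ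
  rwa [one_smul, scaledActivity_one] at h

end KPInduction

/-! ### From finite volumes to the countable polymer set: discharge of the named fact -/

section Discharge

omit [DecidableEq P] in
/-- The global hypothesis (1) of [KP86] (`Σ' over all γ' ι γ`) implies its finite-volume form on
every finite `L`. [cite: KoteckyPreiss1986, (1)] -/
theorem sum_filter_le_of_tsum_le {w : P → ℂ} {a d : P → ℝ}
    (h1 : ∀ γ, Summable (fun γ' : {γ' : P // inc γ' γ} => ‖w γ'‖ * Real.exp (a γ' + d γ')) ∧
      ∑' γ' : {γ' : P // inc γ' γ}, ‖w γ'‖ * Real.exp (a γ' + d γ') ≤ a γ)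
    (L : Finset P) (γ : P) :
    ∑ γ' ∈ L with inc γ' γ, ‖w γ'‖ * Real.exp (a γ' + d γ') ≤ a γ := by
  obtain ⟨hs, hle⟩ := h1 γ
  refine le_trans ?_ hle
  set S : Finset P := L.filter fun γ' => inc γ' γ with hS
  have hSι : ∀ γ' ∈ S, inc γ' γ := fun γ' hγ' => (Finset.mem_filter.1 hγ').2
  set S' : Finset {γ' : P // inc γ' γ} := S.attach.map
    ⟨fun x => ⟨x.1, hSι x.1 x.2⟩, fun x y hxy => by
      simp only [Subtype.mk.injEq] at hxy
      exact Subtype.ext hxy⟩ with hS'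
  calc ∑ γ' ∈ S, ‖w γ'‖ * Real.exp (a γ' + d γ')
      = ∑ x ∈ S', ‖w (x : P)‖ * Real.exp (a x + d x) := by
        rw [hS', Finset.sum_map, ← Finset.sum_attach S]
        rfl
    _ ≤ ∑' γ' : {γ' : P // inc γ' γ}, ‖w γ'‖ * Real.exp (a γ' + d γ') :=
        hs.sum_le_tsum S' fun x _ => mul_nonneg (norm_nonneg _) (Real.exp_nonneg _)

end Discharge

/-- **Discharge of the named fact `koteckyPreiss_truncatedWeight_bound`** — the Kotecký–Preiss
cluster-expansion estimate [KP86, Theorem p. 492, (4)]: for a countable polymer set with a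
reflexive symmetric incompatibility, activities `w` and `a, d ≥ 0` with (1)
`Σ_{γ' ι γ} |w(γ')| e^{a(γ')+d(γ')} ≤ a(γ)`, one has, for every polymer `γ`,
`Σ_{C ι γ} |Φ^T(C)| e^{d(C)} ≤ a(γ)` with absolute convergence. Proof: every finite family of
finite sets touching `γ` lies in a finite volume `L ∋ γ` on which (1) holds, where the
finite-volume estimate `touchSum_le_of_kp` ([KP86, §3 (S)]) applies; nonnegative series with
bounded partial sums converge. [cite: KoteckyPreiss1986, Theorem p. 492, estimate (4)] -/
theorem koteckyPreiss_truncatedWeight_bound_holds [Countable P] (inc : P → P → Prop)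
    [DecidableRel inc] [Std.Refl inc] [Std.Symm inc] (w : P → ℂ) (a d : P → ℝ) :
    koteckyPreiss_truncatedWeight_bound inc w a d := by
  intro ha hd h1 γ
  have hnn : ∀ x : {C : Finset P // KPTouches inc C γ},
      0 ≤ ‖truncatedWeight inc w x‖ * Real.exp (∑ γ' ∈ (x : Finset P), d γ') := fun x =>
    mul_nonneg (norm_nonneg _) (Real.exp_nonneg _)
  have key : ∀ 𝒞 : Finset {C : Finset P // KPTouches inc C γ},
      ∑ x ∈ 𝒞, ‖truncatedWeight inc w x‖ * Real.exp (∑ γ' ∈ (x : Finset P), d γ') ≤ a γ := by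
    intro 𝒞
    set L : Finset P := insert γ (𝒞.biUnion fun x => (x : Finset P)) with hL
    have hγL : γ ∈ L := Finset.mem_insert_self _ _
    have hfin := touchSum_le_of_kp (inc := inc) ha hd
      (fun γ' _ => sum_filter_le_of_tsum_le h1 L γ') hγL
    refine le_trans ?_ hfin
    unfold touchSum
    have hmap : ∑ x ∈ 𝒞, ‖truncatedWeight inc w x‖ * Real.exp (∑ γ' ∈ (x : Finset P), d γ') =
        ∑ C ∈ 𝒞.map (Function.Embedding.subtype _),
          ‖truncatedWeight inc w C‖ * Real.exp (∑ γ' ∈ C, d γ') := by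
      rw [Finset.sum_map]
      rfl
    rw [hmap]
    refine Finset.sum_le_sum_of_subset_of_nonneg ?_ fun C _ _ =>
      mul_nonneg (norm_nonneg _) (Real.exp_nonneg _)
    intro C hC
    rw [Finset.mem_map] at hC
    obtain ⟨x, hx, rfl⟩ := hC
    refine Finset.mem_filter.2 ⟨Finset.mem_powerset.2 fun δ hδ => ?_, x.2⟩
    exact Finset.mem_insert_of_mem (Finset.mem_biUnion.2 ⟨x, hx, hδ⟩)
  exact ⟨summable_of_sum_le hnn key, Real.tsum_le_of_sum_le hnn key⟩

end Literature.Probability.LatticeModels
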